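import Literature.Probability.RandomPlanarGeometry.SLE
import Literature.Probability.RandomPlanarGeometry.LoewnerDescription
import Literature.Probability.RandomPlanarGeometry.ChordalReversibility
import HarnessLib

/-!
# Assembly phase `phase4_marginsB` and anchor `stub_returnsDie_notInj`
(crux `PathUpgradeR`, stmt-CriticalPhenomena-18055, route `SAWReversalUpgrade`,
line `bidir_windows`)

Landing target:
`Summits/CriticalPhenomena/SAWScalingLimit/Theorems/SAWReversalUpgradePathUpgradeRAsmMarginsB.lean`
(`--supports stmt-CriticalPhenomena-18055`; registered anchor `stub_returnsDie_notInj`).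

This file is one phase of the constant cascade behind the lead's stub `stub_returnsDie`
(returns of the lattice curve die), namely the *backward margins* phase: for the backward
instance `(D.swap, φ')` of the SLE(8/3) reference sample `γ = sleTrace (8/3) ω`, a sample `ω`
lying outside the union of the nine backward bad events (uniform continuity at horizon
`T' + 2`, two injectivity events, two driver-oscillation events, the conformal-height event,
the boundary-distance event, the start event and the continuity event at scale `μ₀ / 2`)
satisfies the eight deterministic margins `m1`–`m8` consumed by the perturbation lemmas, plus
the backward continuity clause `contB`.  The statement is generated (it is consumed
positionally by the final assembly); the proof is purely propositional: each margin is the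
contrapositive of the corresponding negated event, after weakening the window parameter along
one of the three links `θ' ≤ τ'`, `θ' + 4 w' ≤ τ₁'`, `c₁ ≤ c'`.

The anchor `stub_returnsDie_notInj` is the generic form of the injectivity step `m2`/`m3`.
-/

namespace Summit.CriticalPhenomena.SAWScalingLimit.Theorems

/-- Registered anchor (line `bidir_windows`): the contrapositive reading of a negated
injectivity event.  If no two times `s, t ≤ T + 1` with `w ≤ |s - t|` have
`dist (r s) (r t) < μ`, then all such pairs satisfy `μ ≤ dist (r s) (r t)`. [folklore] -/
theorem stub_returnsDie_notInj : ∀ (r : NNReal → ℂ) (T w μ : ℝ), (¬ ∃ s t : NNReal, (s : ℝ) ≤ T + 1 ∧ (t : ℝ) ≤ T + 1 ∧ w ≤ |(s : ℝ) - t| ∧ dist (r s) (r t) < μ) → ∀ s t : NNReal, (s : ℝ) ≤ T + 1 → (t : ℝ) ≤ T + 1 → w ≤ |(s : ℝ) - t| → μ ≤ dist (r s) (r t) := by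
  intro r T w μ h s t hs ht hw
  exact not_lt.mp fun hlt => h ⟨s, t, hs, ht, hw, hlt⟩

namespace PathUpgradeRAsm

/-- Assembly phase `phase4_marginsB` (backward margins) of the cascade for `stub_returnsDie`:
outside the nine backward bad events of the SLE(8/3) reference sample seen through `φ'` in
`D.swap`, the eight margins `m1`–`m8` and the continuity clause `contB` hold, given the links
`θ' ≤ τ'`, `θ' + 4 * w' ≤ τ₁'` and `c₁ ≤ c'`.  Purely deterministic, per sample. -/
theorem phase4_marginsB : ∀ (D : Literature.Probability.RandomPlanarGeometry.DobrushinDomain) (φ' : Literature.Probability.RandomPlanarGeometry.ConformalEquiv UpperHalfPlane.upperHalfPlaneSet D.swap.carrier) (T' : NNReal) (ε' μ' μ₀' w' c₁ θ' ρ₁' d'' h₀q' α₀' dB' rbP μ₀ la' τ' τ₁' c' csh' : ℝ), θ' ≤ τ' → θ' + 4 * w' ≤ τ₁' → c₁ ≤ c' → ∀ ω : NNReal → ℝ, ω ∉ {ω | ∃ s t : NNReal, (s : ℝ) ≤ (T' + 1) + 1 ∧ (t : ℝ) ≤ (T' + 1) + 1 ∧ |(s : ℝ) - t| ≤ csh'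 ∧ ε' / 4 ≤ dist (φ'.boundaryExtension (Literature.Probability.RandomPlanarGeometry.sleTrace ((8:NNReal)/3) ω s)) (φ'.boundaryExtension (Literature.Probability.RandomPlanarGeometry.sleTrace ((8:NNReal)/3) ω t))} ∪ {ω | ∃ s t : NNReal, (s : ℝ) ≤ T' + 1 ∧ (t : ℝ) ≤ T' + 1 ∧ w' ≤ |(s : ℝ) - t| ∧ dist (φ'.boundaryExtension (Literature.Probability.RandomPlanarGeometry.sleTrace ((8:NNReal)/3) ω s)) (φ'.boundaryExtension (Literature.Probability.RandomPlanarGeometry.sleTrace ((8:NNReal)/3) ω t)) < μ'} ∪ {ω | ∃ s t : NNReal, (s : ℝ) ≤ T' + 1 ∧ (t : ℝ) ≤ T' + 1 ∧ c₁ / 4 ≤ |(s : ℝ) - t| ∧ dist (φ'.boundaryExtension (Literature.Probability.RandomPlanarGeometry.sleTrace ((8:NNReal)/3) ω s)) (φ'.boundaryExtension (Literature.Probability.RandomPlanarGeometry.sleTrace ((8:NNReal)/3) ω t)) < μ₀'} ∪ {ω | ∃ s s' : NNReal, (s : ℝ) ≤ T' + 1 ∧ (s' : ℝ) ≤ T'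 + 1 ∧ |(s : ℝ) - s'| ≤ τ₁' ∧ ρ₁' / 2 < |Literature.Probability.RandomPlanarGeometry.sleDriving ((8:NNReal)/3) ω s - Literature.Probability.RandomPlanarGeometry.sleDriving ((8:NNReal)/3) ω s'|} ∪ {ω | ∃ s s' : NNReal, (s : ℝ) ≤ T' + 1 ∧ (s' : ℝ) ≤ T' + 1 ∧ |(s : ℝ) - s'| ≤ τ' ∧ Real.sqrt la' / 200 < |Literature.Probability.RandomPlanarGeometry.sleDriving ((8:NNReal)/3) ω s - Literature.Probability.RandomPlanarGeometry.sleDriving ((8:NNReal)/3) ω s'|} ∪ {ω | ∃ e ∈ D.swap.carrier, d'' ≤ Metric.infDist e ((fun v => φ'.boundaryExtension (Literature.Probability.RandomPlanarGeometry.sleTrace ((8:NNReal)/3) ω v)) '' Set.Icc 0 (T' + 1) ∪ frontier D.swap.carrier) ∧ ¬ (((T' : NNReal) : WithTop NNReal) < Literature.Probability.RandomPlanarGeometry.Loewner.swallowingTime (Literature.Probability.RandomPlanarGeometry.sleDriving ((8:NNReal)/3) ω) (φ'.symm e) ∧ h₀q' ≤ (Literature.Probability.RandomPlanarGeometry.Loewner.map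 (Literature.Probability.RandomPlanarGeometry.sleDriving ((8:NNReal)/3) ω) T' (φ'.symm e)).im)} ∪ {ω | ∃ u : NNReal, α₀' / 2 ≤ (u : ℝ) ∧ (u : ℝ) ≤ T' + 1 ∧ Metric.infDist (φ'.boundaryExtension (Literature.Probability.RandomPlanarGeometry.sleTrace ((8:NNReal)/3) ω u)) (frontier D.swap.carrier) < dB'} ∪ {ω | ∃ u : NNReal, (u : ℝ) ≤ α₀' ∧ rbP / 2 ≤ dist (φ'.boundaryExtension (Literature.Probability.RandomPlanarGeometry.sleTrace ((8:NNReal)/3) ω u)) (D.swap.pt 0)} ∪ {ω | ∃ s t : NNReal, (s : ℝ) ≤ T' + 1 ∧ (t : ℝ) ≤ T' + 1 ∧ |(s : ℝ) - t| ≤ c' ∧ μ₀ / 2 ≤ dist (φ'.boundaryExtension (Literature.Probability.RandomPlanarGeometry.sleTrace ((8:NNReal)/3) ω s)) (φ'.boundaryExtension (Literature.Probability.RandomPlanarGeometry.sleTrace ((8:NNReal)/3) ω t))} → ((∀ s t : NNReal, (s : ℝ) ≤ T' + 2 → (t : ℝ) ≤ T' + 2 → |(s : ℝ) - t| ≤ csh'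 → dist (φ'.boundaryExtension (Literature.Probability.RandomPlanarGeometry.sleTrace ((8:NNReal)/3) ω s)) (φ'.boundaryExtension (Literature.Probability.RandomPlanarGeometry.sleTrace ((8:NNReal)/3) ω t)) < ε' / 4) ∧ (∀ s t : NNReal, (s : ℝ) ≤ T' + 1 → (t : ℝ) ≤ T' + 1 → w' ≤ |(s : ℝ) - t| → μ' ≤ dist (φ'.boundaryExtension (Literature.Probability.RandomPlanarGeometry.sleTrace ((8:NNReal)/3) ω s)) (φ'.boundaryExtension (Literature.Probability.RandomPlanarGeometry.sleTrace ((8:NNReal)/3) ω t))) ∧ (∀ s t : NNReal, (s : ℝ) ≤ T' + 1 → (t : ℝ) ≤ T' + 1 → c₁ / 4 ≤ |(s : ℝ) - t| → μ₀' ≤ dist (φ'.boundaryExtension (Literature.Probability.RandomPlanarGeometry.sleTrace ((8:NNReal)/3) ω s)) (φ'.boundaryExtension (Literature.Probability.RandomPlanarGeometry.sleTrace ((8:NNReal)/3) ω t))) ∧ (∀ s s' : NNReal, (s : ℝ) ≤ T' + 1 → (s' : ℝ) ≤ T' + 1 → |(s : ℝ) - s'| ≤ θ' + 4 * w' → |Literature.Probability.RandomPlanarGeometry.sleDriving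 ((8:NNReal)/3) ω s - Literature.Probability.RandomPlanarGeometry.sleDriving ((8:NNReal)/3) ω s'| ≤ ρ₁' / 2) ∧ (∀ s s' : NNReal, (s : ℝ) ≤ T' + 1 → (s' : ℝ) ≤ T' + 1 → |(s : ℝ) - s'| ≤ θ' → |Literature.Probability.RandomPlanarGeometry.sleDriving ((8:NNReal)/3) ω s - Literature.Probability.RandomPlanarGeometry.sleDriving ((8:NNReal)/3) ω s'| ≤ Real.sqrt la' / 200) ∧ (∀ e ∈ D.swap.carrier, d'' ≤ Metric.infDist e ((fun v => φ'.boundaryExtension (Literature.Probability.RandomPlanarGeometry.sleTrace ((8:NNReal)/3) ω v)) '' Set.Icc 0 (T' + 1) ∪ frontier D.swap.carrier) → ((T' : NNReal) : WithTop NNReal) < Literature.Probability.RandomPlanarGeometry.Loewner.swallowingTime (Literature.Probability.RandomPlanarGeometry.sleDriving ((8:NNReal)/3) ω) (φ'.symm e) ∧ 2 * (h₀q' / 2) ≤ (Literature.Probability.RandomPlanarGeometry.Loewner.map (Literature.Probability.RandomPlanarGeometry.sleDriving ((8:NNReal)/3) ω) T' (φ'.symm e)).im) ∧ (∀ u : NNReal,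 α₀' / 2 ≤ (u : ℝ) → (u : ℝ) ≤ T' + 1 → dB' ≤ Metric.infDist (φ'.boundaryExtension (Literature.Probability.RandomPlanarGeometry.sleTrace ((8:NNReal)/3) ω u)) (frontier D.swap.carrier)) ∧ (∀ u : NNReal, (u : ℝ) ≤ α₀' → dist (φ'.boundaryExtension (Literature.Probability.RandomPlanarGeometry.sleTrace ((8:NNReal)/3) ω u)) (D.swap.pt 0) < rbP / 2) ∧ (∀ s t : NNReal, (s : ℝ) ≤ T' + 1 → (t : ℝ) ≤ T' + 1 → |(s : ℝ) - t| ≤ c₁ →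
    dist (φ'.boundaryExtension (Literature.Probability.RandomPlanarGeometry.sleTrace ((8:NNReal)/3) ω s)) (φ'.boundaryExtension (Literature.Probability.RandomPlanarGeometry.sleTrace ((8:NNReal)/3) ω t)) < μ₀ / 2)) := by
  intro D φ' T' ε' μ' μ₀' w' c₁ θ' ρ₁' d'' h₀q' α₀' dB' rbP μ₀ la' τ' τ₁' c' csh' hτ hτ₁ hc
    ω hω
  simp only [Set.mem_union, Set.mem_setOf_eq, not_or] at hω
  obtain ⟨⟨⟨⟨⟨⟨⟨⟨h1, h2⟩, h3⟩, h4⟩, h5⟩, h6⟩, h7⟩, h8⟩, h9⟩ := hω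
  refine ⟨?_, ?_, ?_, ?_, ?_, ?_, ?_, ?_, ?_⟩
  · -- m1: uniform continuity at horizon `T' + 2 = (T' + 1) + 1`, scale `ε' / 4`
    intro s t hs ht hst
    exact not_le.mp fun hle => h1 ⟨s, t, by linarith, by linarith, hst, hle⟩
  · -- m2: injectivity at separation `w'`
    exact stub_returnsDie_notInj
      (fun u => φ'.boundaryExtension
        (Literature.Probability.RandomPlanarGeometry.sleTrace ((8:NNReal)/3) ω u)) T' w' μ' h2
  · -- m3: injectivity at separation `c₁ / 4`
    exact stub_returnsDie_notInj
      (fun u => φ'.boundaryExtension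
        (Literature.Probability.RandomPlanarGeometry.sleTrace ((8:NNReal)/3) ω u))
      T' (c₁ / 4) μ₀' h3
  · -- m4: driver oscillation over windows `≤ θ' + 4 w' ≤ τ₁'`
    intro s s' hs hs' hd
    exact not_lt.mp fun hlt => h4 ⟨s, s', hs, hs', hd.trans hτ₁, hlt⟩
  · -- m5: driver oscillation over windows `≤ θ' ≤ τ'`
    intro s s' hs hs' hd
    exact not_lt.mp fun hlt => h5 ⟨s, s', hs, hs', hd.trans hτ, hlt⟩
  · -- m6: conformal height, `2 * (h₀q' / 2) = h₀q'`
    intro e he hd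
    obtain ⟨hsw, him⟩ := not_not.mp fun hn => h6 ⟨e, he, hd, hn⟩
    exact ⟨hsw, by linarith⟩
  · -- m7: distance to the boundary after time `α₀' / 2`
    intro u hu huT
    exact not_lt.mp fun hlt => h7 ⟨u, hu, huT, hlt⟩
  · -- m8: the start stays within `rbP / 2` of `D.swap.pt 0` up to time `α₀'`
    intro u hu
    exact not_le.mp fun hle => h8 ⟨u, hu, hle⟩
  · -- contB: continuity at scale `μ₀ / 2` over windows `≤ c₁ ≤ c'`
    intro s t hs ht hst
    exact not_le.mp fun hle => h9 ⟨s, t, hs, ht, hst.trans hc, hle⟩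

end PathUpgradeRAsm

end Summit.CriticalPhenomena.SAWScalingLimit.Theorems
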